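/-
Copyright: lit-balaban Phase-2 proof seat p30 (gen 3).  Statement-level skeleton of a published paper; no proof claims beyond what
the kernel checks below.
-/
import Literature.MathematicalPhysics.QuantumFieldTheory.BalabanImbrieJaffe1984to88.BIJ85Eq531Inputs
import Literature.MathematicalPhysics.QuantumFieldTheory.BalabanImbrieJaffe1984to88.BIJ85AxialMinimizer413

/-!
# `BalabanImbrieJaffe1984to88.BIJ85Eq531Proof` — T. Bałaban, J. Imbrie, A. Jaffe, *Renormalization of the Higgs model: minimizers,
propagators and the stability of mean field theory*, Commun. Math. Phys. **97** (1985) 299–329 [BalabanImbrieJaffe1985]: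
**(5.3.1)** `H_{k,Ax}B = Q^{s*}_kB − G_{k,Ax}∂^*Q^{e*}_k∂B` PROVED on the tori of the series

statement-level skeleton of published theorems with citation tags; proofs where landed; nothing here is a claim about the Yang–Mills mass gap

PDF held: `paper:balaban1985-cmp97-bij-higgs-minimizers` (journal page = PDF page + 298).  Page read as image:
`run/shared/lean/pub/lit-balaban/lit-balaban-r15/pages/1985-cmp97-bij-higgs-minimizers-p019-x2.png` (p. 317 [PDF 19]).

CITATION HEADER (lean-in-tree rule).  Part of the lit-balaban TYPED SKELETON (HOME `run/shared/lean/pub/lit-balaban/`), Phase-2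
seat p30 (gen 3); row **C1.Eq5.3.1** of `HOME/SKELETON.md` (reader file `HOME/lit-balaban-r15/ROWS-C1.md`).  THE PRINTED TEXT,
p. 317, verbatim: *"5.3. Minimizers and Green's Functions. To help define the fluctuation field in the (k+1)st step, we need one
more identity, namely H_{k,Ax}B = Q^{s*}_kB − G_{k,Ax}∂^*Q^{e*}_k∂B. (5.3.1) This identity follows by inspecting the definition
(4.1.3) after the translation A = A′ + Q^{s*}_kB. Use the facts Q_kQ^{s*}_k = I and ∂Q^{s*}_kB = Q^{e*}_k∂B to obtain
H_{k,Ax}B = Z_{k,Ax}(B)^{−1}∫𝒟A′δ(Q_kA′)δ_{k,Ax}(A′)(A′ + Q^{s*}_kB)exp(−½‖∂A′ + Q^{e*}_k∂B‖²). The second term yields Q^{s*}_kB.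
In the first term we translate to the minimum of the quadratic form which is G_{k,Ax}∂^*Q^{e*}_k∂B. We see this by
integrating."*  WHAT IS REPRODUCED, and how.  The Gaussian computation ("we see this by integrating") is seat p09's
`BIJ85AxialMinimizer413.Hax_eq_minimizer` (for any representative `A₀` of the constraint class: `H_{k,Ax} = A₀ − G_{k,Ax}∂^*∂A₀`,
with `G_{k,Ax}` the operator of (4.1.1) = `BIJ85AxialPropagator411.axialPropagator`, on the torus `torusHax` / `torusPropagator`);
the two "facts" and the translation are `BIJ85Eq531Inputs` (seat p30: `Q_kQ^{s*}_k = I`, `δ_{k,Ax}(Q^{s*}_kB)`,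
`∂Q^{s*}_k = Q^{e*}_k∂` for the k-fold composites `QsstarIter`/`QestarIter` of the one-step operators of seats p31/p31 gen 2).  Here:
* §1 the adjoint `∂^*` of the lattice curl on plaquette fields of `T^{(j)}` — `plaqDiv c`, DEFINED as the transpose of
  `LatticeFieldCalculus.curl c` for the pairings (2.14)/(2.20) (equal weights `a^d` on the bonds and the plaquettes of one lattice, so
  the weighted adjoint is the plain transpose), with the adjointness `Σ_p (∂A)(p)F(p) = Σ_b A_b(∂^*F)(b)` PROVED (`sum_curl_mul`);
  it is the `∂^*` of (4.2.2)/(5.2.x)/(5.3.1) and of [Balaban1984PropagatorsI] (1.69) `Δ = ∂^*∂ + ∂∂^*` on vector fields;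
* §2 the bridge to p09's Euclidean encoding: `adjoint(curlOp w c) = √w·∂^*` (`adjoint_curlOp`) and, for EVERY representative,
  **`H_{k,Ax}(A₀) = A₀ − G_{k,Ax}∂^*∂A₀` on the torus** with `G_{k,Ax}` = `torusPropagator w c k` (`torusHax_eq_sub_propagator`);
* §3 **(5.3.1)**: with `A₀ = Q^{s*}_kB` (`QsstarIter k B`, a representative of the class `{Q_kA = B, δ_{k,Ax}(A)}` by
  `QsstarIter_representative`) and `∂Q^{s*}_kB = Q^{e*}_k∂B` (`curl_QsstarIter`),
  `H_{k,Ax}B = Q^{s*}_kB − G_{k,Ax}∂^*Q^{e*}_k∂B` (`eq531_torus`; η-units `eq531_torus_eta`), together with (4.1.5) for this very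
  field, `Q_k(H_{k,Ax}B) = B` and `δ_{k,Ax}(H_{k,Ax}B)` (`bondAvgIter_Hax`, `deltaAx_Hax`).
Standing range `k ≤ m + K`, `2 ≤ d`, weight `w = η^d > 0`, curl factor `c` on `T^{(0)} = T_η` (coarse factor `c/L^k`; `c = η⁻¹ = L^k`
in the paper's units), and the no-zero-modes claim of p. 309 as the hypothesis `hD` exactly as in p09's files (k = 1 proved by seat
p33, `BIJ85NoZeroModes309Proof`).  Unit `lit-balaban-p30` (literature-prover-lit-balaban-p30-g3-0), 2026-08-21.
-/

open scoped BigOperators RealInnerProductSpace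

namespace Literature.MathematicalPhysics.QuantumFieldTheory.BalabanImbrieJaffe1984to88.BIJ85Eq531Proof

open Literature.MathematicalPhysics.QuantumFieldTheory.Balaban1983to89
open LatticeFieldCalculus BIJ85Eq219Proof BIJ85CurlQsstar BIJ85Eq531Inputs BIJ85AxialPropagator411 BIJ85AxialMinimizer413

variable {P : Params}

/-! ## 1. `∂^*` on plaquette fields: the adjoint of the lattice curl -/

section PlaqDiv

variable {j : ℕ}

open Classical in
/-- **`∂^*` on plaquette fields** (2-forms → 1-forms) of `T^{(j)}`: the adjoint of `∂` = `LatticeFieldCalculus.curl c` for the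
pairings `⟨A, B⟩_a = Σ_b a^dA_bB_b` (2.14) and `⟨f, g⟩_a = Σ_p a^df_pg_p` (2.20) of ONE lattice (equal weights, so the adjoint is
the plain transpose), DEFINED as that transpose: `(∂^*F)(b) = Σ_p (∂e_b)(p)F(p)`, `e_b` the indicator of the bond `b` — the operator
`∂^*` of (4.2.2) `σ_k = Q^e_k(I − ∂G_{k,Ax}∂^*)Q^{e*}_k`, of (5.2.10) and of (5.3.1); [Balaban1984PropagatorsI] (1.69) writes
`Δ = ∂^*∂ + ∂∂^*` with it.  Explicitly `(∂^*F)(⟨x, x+e_κ⟩) = c·(Σ_{ν>κ}(F(p_{κν}(x)) − F(p_{κν}(x − e_ν))) + Σ_{μ<κ}(F(p_{μκ}(x − e_μ))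
− F(p_{μκ}(x))))`. [cite: BalabanImbrieJaffe1985, (4.2.2) p.310] -/
noncomputable def plaqDiv (c : ℝ) (F : Plaq P j → ℝ) : VecField P j ℝ :=
  fun b => ∑ p : Plaq P j, curl c (Pi.single b (1 : ℝ)) p * F p

open Classical in
/-- kernel: the curl is linear — expansion of `(∂A)(p)` in the bond basis, `(∂A)(p) = Σ_b A_b(∂e_b)(p)`.
[cite: Balaban1984PropagatorsI, (1.2) p.18] -/
theorem curl_eq_sum_single (c : ℝ) (A : VecField P j ℝ) (p : Plaq P j) :
    curl c A p = ∑ b : PBond P j, A b * curl c (Pi.single b (1 : ℝ)) p := by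
  have h : ∀ q : PBond P j, ∑ b : PBond P j, A b * (Pi.single b (1 : ℝ) : PBond P j → ℝ) q = A q := fun q => by
    simp only [Pi.single_apply, mul_ite, mul_one, mul_zero, Finset.sum_ite_eq, Finset.mem_univ, if_true]
  calc curl c A p = c * (A ⟨p.src, p.μ⟩ + A ⟨p.src.shift p.μ, p.ν⟩ - A ⟨p.src.shift p.ν, p.μ⟩ - A ⟨p.src, p.ν⟩) := by
        simp only [curl, smul_eq_mul]
    _ = c * (∑ b, A b * (Pi.single b (1 : ℝ) : PBond P j → ℝ) ⟨p.src, p.μ⟩ + ∑ b, A b * (Pi.single b (1 : ℝ) : PBond P j → ℝ) ⟨p.src.shift p.μ, p.ν⟩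
          - ∑ b, A b * (Pi.single b (1 : ℝ) : PBond P j → ℝ) ⟨p.src.shift p.ν, p.μ⟩ - ∑ b, A b * (Pi.single b (1 : ℝ) : PBond P j → ℝ) ⟨p.src, p.ν⟩) := by
        rw [h, h, h, h]
    _ = ∑ b, A b * curl c (Pi.single b (1 : ℝ)) p := by
        rw [← Finset.sum_add_distrib, ← Finset.sum_sub_distrib, ← Finset.sum_sub_distrib, Finset.mul_sum]
        refine Finset.sum_congr rfl fun b _ => ?_
        simp only [curl, smul_eq_mul]
        ring

/-- **`∂^*` IS THE ADJOINT OF `∂`**: `Σ_p (∂A)(p)F(p) = Σ_b A_b(∂^*F)(b)` for every bond field `A` and plaquette field `F` of one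
lattice (multiply both sides by the common weight `a^d` for the printed pairings (2.14)/(2.20)). [cite: BalabanImbrieJaffe1985, (4.2.2) p.310] -/
theorem sum_curl_mul (c : ℝ) (A : VecField P j ℝ) (F : Plaq P j → ℝ) :
    ∑ p : Plaq P j, curl c A p * F p = ∑ b : PBond P j, A b * plaqDiv c F b := by
  classical
  have h1 : ∑ p : Plaq P j, curl c A p * F p = ∑ p : Plaq P j, ∑ b : PBond P j, A b * (curl c (Pi.single b (1 : ℝ)) p * F p) := by
    refine Finset.sum_congr rfl fun p _ => ?_
    rw [curl_eq_sum_single c A p, Finset.sum_mul]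
    exact Finset.sum_congr rfl fun b _ => by ring
  rw [h1, Finset.sum_comm]
  refine Finset.sum_congr rfl fun b _ => ?_
  rw [plaqDiv, Finset.mul_sum]

/-- kernel: `∂^*` is homogeneous. [cite: BalabanImbrieJaffe1985, (4.2.2) p.310] -/
theorem plaqDiv_smul (c a : ℝ) (F : Plaq P j → ℝ) : plaqDiv c (fun p => a * F p) = a • plaqDiv c F := by
  funext b
  simp only [plaqDiv, Pi.smul_apply, smul_eq_mul, Finset.mul_sum]
  refine Finset.sum_congr rfl fun p _ => ?_
  ring

/-- kernel: `∂^*` is additive. [cite: BalabanImbrieJaffe1985, (4.2.2) p.310] -/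
theorem plaqDiv_add (c : ℝ) (F G : Plaq P j → ℝ) : plaqDiv c (fun p => F p + G p) = plaqDiv c F + plaqDiv c G := by
  funext b
  simp only [plaqDiv, Pi.add_apply, mul_add, Finset.sum_add_distrib]

end PlaqDiv

/-! ## 2. The bridge to the Euclidean encoding of `BIJ85AxialPropagator411`: `adjoint(∂) = √w·∂^*`, `H_{k,Ax} = A₀ − G_{k,Ax}∂^*∂A₀` -/

section Torus

/-- Components are unchanged by the identification `toE`. [folklore] -/
private theorem toE_apply' (A : VecField P 0 ℝ) (b : PBond P 0) : toE P A b = A b := rfl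

/-- Components are unchanged by the inverse identification. [folklore] -/
private theorem toE_symm_apply' (v : BondSpace P) (b : PBond P 0) : (toE P).symm v b = v b := rfl

/-- Components of p09's weighted curl `curlOp w c`. [folklore] -/
private theorem curlOp_apply' (w c : ℝ) (v : BondSpace P) (p : Plaq P 0) :
    curlOp (P := P) w c v p = Real.sqrt w * curl c ((toE P).symm v) p := rfl

/-- The `ℓ²` inner product of plaquette vectors as a sum of products of components. [folklore] -/
private theorem inner_plaq (x y : PlaqSpace P) : ⟪x, y⟫ = ∑ p : Plaq P 0, x p * y p := by
  simp [PiLp.inner_apply, mul_comm]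

/-- The `ℓ²` inner product of bond vectors as a sum of products of components. [folklore] -/
private theorem inner_bond (x y : BondSpace P) : ⟪x, y⟫ = ∑ b : PBond P 0, x b * y b := by
  simp [PiLp.inner_apply, mul_comm]

/-- **The Hilbert adjoint of p09's `curlOp w c` (`= √w·∂` between the unweighted `ℓ²` spaces) is `√w·∂^*`**: for every plaquette
vector `G`, `adjoint(curlOp w c)G = √w·∂^*G` componentwise — so `adjoint(∂)∂ = w·∂^*∂` and p09's `axialPropagator ∘ adjoint(∂)` is
`G_{k,Ax}∂^*` in the printed normalisation (`torusPropagator = w·axialPropagator`). [cite: BalabanImbrieJaffe1985, (4.1.1) p.309] -/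
theorem adjoint_curlOp (w c : ℝ) (G : PlaqSpace P) :
    (toE P).symm (LinearMap.adjoint (curlOp (P := P) w c) G) = Real.sqrt w • plaqDiv c (fun p => G p) := by
  have key : LinearMap.adjoint (curlOp (P := P) w c) G = toE P (Real.sqrt w • plaqDiv c (fun p => G p)) := by
    apply ext_inner_left ℝ
    intro v
    rw [LinearMap.adjoint_inner_right, inner_plaq, inner_bond]
    simp only [curlOp_apply', toE_apply', Pi.smul_apply, smul_eq_mul]
    have h := sum_curl_mul c ((toE P).symm v) (fun p => G p)
    simp only [toE_symm_apply'] at h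
    have h2 : ∀ p : Plaq P 0, Real.sqrt w * curl c ((toE P).symm v) p * G p
        = Real.sqrt w * (curl c ((toE P).symm v) p * G p) := fun p => by ring
    simp only [h2, ← Finset.mul_sum, h]
    rw [Finset.mul_sum]
    exact Finset.sum_congr rfl fun b _ => by ring
  rw [key, LinearEquiv.symm_apply_apply]

/-- `G_{k,Ax}` on the torus unfolded: `torusPropagator w c k X = w·ι⁻¹(axialPropagator(ιX))`. [cite: BalabanImbrieJaffe1985, (4.1.1) p.309] -/
theorem torusPropagator_apply (w c : ℝ) (k : ℕ) (X : VecField P 0 ℝ) :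
    torusPropagator w c k X = w • (toE P).symm (axialPropagator (V411 P k) (curlOp (P := P) w c) (toE P X)) := by
  simp [torusPropagator]

/-- **`H_{k,Ax}(A₀) = A₀ − G_{k,Ax}∂^*∂A₀` ON THE TORUS, for every representative `A₀`** — p09's `Hax_eq_minimizer` (*"we
translate to the minimum of the quadratic form … We see this by integrating"*) with `adjoint(∂)∂ = w·∂^*∂` (`adjoint_curlOp`) and
`G_{k,Ax} = w·axialPropagator` (`torusPropagator`): weight `w = η^d > 0`, curl factor `c`, no zero modes (`hD`, p. 309).
[cite: BalabanImbrieJaffe1985, (5.3.1) p.317] -/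
theorem torusHax_eq_sub_propagator {w : ℝ} (hw : 0 < w) (c : ℝ) (k : ℕ)
    (hD : ∀ A : VecField P 0 ℝ, A ∈ (constraint411 k : Submodule ℝ (VecField P 0 ℝ)) → (∀ p, curl c A p = 0) → A = 0)
    (A₀ : VecField P 0 ℝ) :
    torusHax w c k A₀ = A₀ - torusPropagator w c k (plaqDiv c (curl c A₀)) := by
  have hD' := noZeroModes_V411 hw c k hD
  have hadj : LinearMap.adjoint (curlOp (P := P) w c) (curlOp (P := P) w c (toE P A₀)) = toE P (w • plaqDiv c (curl c A₀)) := by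
    have h1 := adjoint_curlOp w c (curlOp (P := P) w c (toE P A₀))
    have h2 : (fun p => curlOp (P := P) w c (toE P A₀) p) = fun p => Real.sqrt w * curl c A₀ p := by
      funext p
      rw [curlOp_apply', LinearEquiv.symm_apply_apply]
    rw [h2, plaqDiv_smul, smul_smul, ← Real.sqrt_mul hw.le, Real.sqrt_mul_self hw.le] at h1
    rw [← h1, LinearEquiv.apply_symm_apply]
  unfold torusHax
  rw [Hax_eq_minimizer hD', minimizer, hadj, map_sub, LinearEquiv.symm_apply_apply, torusPropagator_apply, map_smul, map_smul,
    map_smul]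

/-! ## 3. (5.3.1) -/

/-- kernel: `∂Q^{s*}_kB = Q^{e*}_k∂B` with the fine curl factor `c` on `T^{(0)}` and the coarse factor `c/L^k` on `T^{(k)}`
(`BIJ85Eq531Inputs.curl_QsstarIter` rescaled). [cite: BalabanImbrieJaffe1985, (5.3.1) p.317] -/
theorem curl_QsstarIter_div (hd : 2 ≤ P.d) {k : ℕ} (hk : k ≤ P.m + P.K) (c : ℝ) (B : PBond P k → ℝ) :
    curl c (QsstarIter k B) = QestarIter hd k (curl (c / (P.L : ℝ) ^ k) B) := by
  have hL : (P.L : ℝ) ^ k ≠ 0 := pow_ne_zero _ (Nat.cast_ne_zero.mpr P.L_pos.ne')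
  have h := curl_QsstarIter hd hk (c / (P.L : ℝ) ^ k) B
  rwa [mul_div_cancel₀ c hL] at h

/-- **(5.3.1)** p. 317 [PDF 19], verbatim: *"H_{k,Ax}B = Q^{s*}_kB − G_{k,Ax}∂^*Q^{e*}_k∂B. (5.3.1)"* — PROVED on the tori of
the series: with `H_{k,Ax}` = p09's `torusHax w c k` evaluated on the representative `Q^{s*}_kB = QsstarIter k B` of the class
`{Q_kA = B, δ_{k,Ax}(A)}` (by `Q_kQ^{s*}_k = I` and `δ_{k,Ax}(Q^{s*}_kB)`), `G_{k,Ax}` = `torusPropagator w c k`, `∂^*` = `plaqDiv c`,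
`Q^{e*}_k` = `QestarIter`, and `∂` on the unit lattice `T^{(k)}` with factor `c/L^k` (by `∂Q^{s*}_k = Q^{e*}_k∂`).  Hypotheses:
`w = η^d > 0`, the p. 309 no-zero-modes claim `hD`, standing range `k ≤ m + K`, `2 ≤ d`. [cite: BalabanImbrieJaffe1985, (5.3.1) p.317] -/
theorem eq531_torus (hd : 2 ≤ P.d) {k : ℕ} (hk : k ≤ P.m + P.K) {w : ℝ} (hw : 0 < w) (c : ℝ)
    (hD : ∀ A : VecField P 0 ℝ, A ∈ (constraint411 k : Submodule ℝ (VecField P 0 ℝ)) → (∀ p, curl c A p = 0) → A = 0)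
    (B : PBond P k → ℝ) :
    torusHax w c k (QsstarIter k B) =
      QsstarIter k B - torusPropagator w c k (plaqDiv c (QestarIter hd k (curl (c / (P.L : ℝ) ^ k) B))) := by
  rw [torusHax_eq_sub_propagator hw c k hD, curl_QsstarIter_div hd hk]

/-- **(5.3.1)** in the units of Sects. 4–5: `T^{(0)} = T_η` with curl factor `η⁻¹ = L^k`, the unit lattice `T^{(k)}` with factor
`1` — `H_{k,Ax}B = Q^{s*}_kB − G_{k,Ax}∂^*Q^{e*}_k∂B` with `∂B` the unit-lattice curl. [cite: BalabanImbrieJaffe1985, (5.3.1) p.317] -/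
theorem eq531_torus_eta (hd : 2 ≤ P.d) {k : ℕ} (hk : k ≤ P.m + P.K) {w : ℝ} (hw : 0 < w)
    (hD : ∀ A : VecField P 0 ℝ, A ∈ (constraint411 k : Submodule ℝ (VecField P 0 ℝ)) →
      (∀ p, curl ((P.L : ℝ) ^ k) A p = 0) → A = 0)
    (B : PBond P k → ℝ) :
    torusHax w ((P.L : ℝ) ^ k) k (QsstarIter k B) =
      QsstarIter k B - torusPropagator w ((P.L : ℝ) ^ k) k (plaqDiv ((P.L : ℝ) ^ k) (QestarIter hd k (curl 1 B))) := by
  have hL : (P.L : ℝ) ^ k ≠ 0 := pow_ne_zero _ (Nat.cast_ne_zero.mpr P.L_pos.ne')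
  rw [eq531_torus hd hk hw _ hD, div_self hL]

/-- **(4.1.5) for the field of (5.3.1)**: `Q_k(H_{k,Ax}B) = B` — verbatim *"Note that by definition Q_kH_{k,Ax}B = B. (4.1.5)"* —
now with the coarse field `B` itself on the right (p09's `torus_eq415` gives `Q_k(H_{k,Ax}A₀) = Q_kA₀` for a representative; here
`A₀ = Q^{s*}_kB` and `Q_kQ^{s*}_kB = B`). [cite: BalabanImbrieJaffe1985, (4.1.5) p.310] -/
theorem bondAvgIter_Hax {k : ℕ} (hk : k ≤ P.m + P.K) {w : ℝ} (hw : 0 < w) (c : ℝ)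
    (hD : ∀ A : VecField P 0 ℝ, A ∈ (constraint411 k : Submodule ℝ (VecField P 0 ℝ)) → (∀ p, curl c A p = 0) → A = 0)
    (B : PBond P k → ℝ) :
    bondAvgIter k (torusHax w c k (QsstarIter k B)) = B := by
  rw [(torus_eq415 hw c k hD (QsstarIter k B)).1, bondAvgIter_QsstarIter hk]

/-- `H_{k,Ax}B` of (5.3.1) satisfies the axial gauge conditions `δ_{k,Ax}` (it lies in the class of `Q^{s*}_kB`, which does).
[cite: BalabanImbrieJaffe1985, (4.1.5) p.310] -/
theorem deltaAx_Hax {k : ℕ} (hk : k ≤ P.m + P.K) {w : ℝ} (hw : 0 < w) (c : ℝ)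
    (hD : ∀ A : VecField P 0 ℝ, A ∈ (constraint411 k : Submodule ℝ (VecField P 0 ℝ)) → (∀ p, curl c A p = 0) → A = 0)
    (B : PBond P k → ℝ) :
    deltaAx k (torusHax w c k (QsstarIter k B)) :=
  (torus_eq415 hw c k hD (QsstarIter k B)).2 (deltaAx_QsstarIter hk B)

/-- **`H_{k,Ax}B` MINIMIZES `½‖∂A‖²` on `{Q_kA = B, δ_{k,Ax}(A)}`** (p. 310: *"H_{k,Ax} … maps B into such a minimizing
configuration"*), for the field of (5.3.1): every `A` with `Q_kA = B` and `δ_{k,Ax}(A)` has `½Σ_pη^d|(∂H_{k,Ax}B)(p)|² ≤ ½Σ_pη^d|(∂A)(p)|²`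
(p09's `torus_minimizes` + the translation `sub_QsstarIter_mem_constraint411`). [cite: BalabanImbrieJaffe1985, (4.1.3) p.310] -/
theorem Hax_minimizes {k : ℕ} (hk : k ≤ P.m + P.K) {w : ℝ} (hw : 0 < w) (c : ℝ)
    (hD : ∀ A : VecField P 0 ℝ, A ∈ (constraint411 k : Submodule ℝ (VecField P 0 ℝ)) → (∀ p, curl c A p = 0) → A = 0)
    (B : PBond P k → ℝ) {A : VecField P 0 ℝ} (hQ : bondAvgIter k A = B) (hAx : deltaAx k A) :
    curlAction w c (torusHax w c k (QsstarIter k B)) ≤ curlAction w c A :=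
  torus_minimizes hw c k hD (QsstarIter k B) (sub_QsstarIter_mem_constraint411 hk hQ hAx)

end Torus

end Literature.MathematicalPhysics.QuantumFieldTheory.BalabanImbrieJaffe1984to88.BIJ85Eq531Proof
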